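import Literature.AnabelianGeometry.SemiGraphs.CoverticialVertexCase
import Literature.AnabelianGeometry.SemiGraphs.CoverticialProofs
import HarnessLib

/-!
# [SemiAnbd] Proposition 2.6 (Commensurability) — assembly

Mochizuki, *Semi-graphs of anabelioids*, Publ. RIMS **42** (2006), Proposition 2.6, author's
manuscript pp. 28–29 [cite: MochizukiSemiAnbd2006, Prop. 2.6 pp.28-29].  Assembly of abc-iut-L3-t1's
named fact `proposition_2_6` (`Coverticial.lean`, rev. 3 binders: `ℍ`, `𝕂` connected sub-GRAPHS) from
its two cases:

* the case of an ELEVATED VERTEX `v ∈ ℍ ∖ 𝕂` — `proposition_2_6_i_of_isElevated`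
  (`CoverticialVertexCase.lean`, unconditional): `proposition_2_6_of_isElevated` gives BOTH printed
  conclusions in that case (the second, "no conjugate of `Π_ℍ` is commensurable to a conjugate of
  `Π_𝕂`", by abc-iut-L3-d1's `not_commensurable_conj_of_relIndex_eq_zero`);
* the case of a SUB-COVERTICIAL EDGE `e ∈ ℍ ∖ 𝕂` — print p. 29: "it suffices [by replacing `𝒢` by a
  finite étale covering of `𝒢`] to show … under the assumption that `ℍ` contains a pair of distinct
  coverticial edges"; the coverticial-PAIR statement is abc-iut-L3-d1's
  `relIndex_conj_piK_piH_eq_zero_of_coverticial` (`CoverticialEdgeCasePair.lean`), and the descent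
  along the finite étale covering is the finite-étale-covering dictionary of [SemiAnbd] §2 (cell
  ruling ω, `FiniteEtaleCoveringDictionary.lean`, discharge in progress).  Accordingly
  `proposition_2_6_of_edgeCase` reduces `proposition_2_6` to EXACTLY the printed sub-coverticial edge
  statement, taken as an explicit hypothesis (no new definition; nothing is asserted about it here).

Proof-only. Seat abc-iut-L6-t18 (ROW «G21/Prop 2.6 ASSEMBLY», abc-iut-L3-lead 2026-08-25T22:14:41Z).
-/

namespace Literature.AnabelianGeometry.SemiGraphs

open CategoryTheory CategoryTheory.PreGaloisCategory
open scoped Pointwise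

universe v₁ u₁ u

namespace SemiGraphOfAnabelioids

/-- **[SemiAnbd] Proposition 2.6 in the case of an elevated vertex**, both printed conclusions
("infinite index"; "in particular, no conjugate of `Π_ℍ` is commensurable to a conjugate of `Π_𝕂`"),
with the binders of `proposition_2_6` (rev. 3). [cite: MochizukiSemiAnbd2006, Prop. 2.6 pp.28-29] -/
theorem proposition_2_6_of_isElevated (𝒢 : SemiGraphOfAnabelioids.{v₁, u₁, u})
    (hc : 𝒢.IsConnected) (hgr : 𝒢.IsGraphOfAnabelioids) (hqc : 𝒢.IsQuasiCoherent)
    (H K : 𝒢.graph.Subgraph) (hH : H.toSemiGraph.IsConnected) (hK : K.toSemiGraph.IsConnected)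
    (_hHg : H.toSemiGraph.IsGraph) (_hKg : K.toSemiGraph.IsGraph)
    (hv : ∃ v, v ∈ H.verts ∧ v ∉ K.verts ∧ 𝒢.IsElevated v)
    (w : H.toSemiGraph.Vertex) (F : 𝒢.V w.1 ⥤ FintypeCat.{v₁}) [FiberFunctor F]
    (w' : K.toSemiGraph.Vertex) (F' : 𝒢.V w'.1 ⥤ FintypeCat.{v₁}) [FiberFunctor F']
    (α : 𝒢.ρ w'.1 ⋙ F' ≅ 𝒢.ρ w.1 ⋙ F) :
    (∀ g : 𝒢.Pi w.1 F, (ConjAct.toConjAct g •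
        ((Aut.autMulEquivOfIso α).toMonoidHom.comp (𝒢.piHToPi K w' F')).range).relIndex
        (𝒢.piHToPi H w F).range = 0) ∧
      ∀ g g' : 𝒢.Pi w.1 F, ¬ Subgroup.Commensurable (ConjAct.toConjAct g • (𝒢.piHToPi H w F).range)
        (ConjAct.toConjAct g' •
          ((Aut.autMulEquivOfIso α).toMonoidHom.comp (𝒢.piHToPi K w' F')).range) := by
  obtain ⟨v, hvH, hvK, hv⟩ := hv
  have h1 : ∀ g : 𝒢.Pi w.1 F, (ConjAct.toConjAct g •
      ((Aut.autMulEquivOfIso α).toMonoidHom.comp (𝒢.piHToPi K w' F')).range).relIndex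
      (𝒢.piHToPi H w F).range = 0 := fun g =>
    proposition_2_6_i_of_isElevated 𝒢 hc hgr hqc H K hH hK v hvH hvK hv w F w' F' α g
  exact ⟨h1, not_commensurable_conj_of_relIndex_eq_zero h1⟩

/-- **Assembly of [SemiAnbd] Proposition 2.6** from its two cases: the named fact `proposition_2_6`
follows from the printed statement for a sub-coverticial edge `e ∈ ℍ ∖ 𝕂` alone ("it suffices [by
replacing `𝒢` by a finite étale covering of `𝒢`] to show that `Π_𝕂 ∩ Π_ℍ` has infinite index in `Π_ℍ`
under the assumption that `ℍ` contains a pair of distinct coverticial edges", p. 29) — the vertex case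
being `proposition_2_6_i_of_isElevated` and the second conclusion formal.
[cite: MochizukiSemiAnbd2006, Prop. 2.6 pp.28-29] -/
theorem proposition_2_6_of_edgeCase
    (hedge : ∀ (𝒢 : SemiGraphOfAnabelioids.{v₁, u₁, u}), 𝒢.IsConnected → 𝒢.IsGraphOfAnabelioids →
      𝒢.IsQuasiCoherent → ∀ (H K : 𝒢.graph.Subgraph), H.toSemiGraph.IsConnected →
      K.toSemiGraph.IsConnected → H.toSemiGraph.IsGraph → K.toSemiGraph.IsGraph →
      ∀ e : 𝒢.graph.Edge, e ∈ H.edges → e ∉ K.edges → 𝒢.IsSubCoverticial e →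
      ∀ (w : H.toSemiGraph.Vertex) (F : 𝒢.V w.1 ⥤ FintypeCat.{v₁}) [FiberFunctor F]
        (w' : K.toSemiGraph.Vertex) (F' : 𝒢.V w'.1 ⥤ FintypeCat.{v₁}) [FiberFunctor F']
        (α : 𝒢.ρ w'.1 ⋙ F' ≅ 𝒢.ρ w.1 ⋙ F) (g : 𝒢.Pi w.1 F),
        (ConjAct.toConjAct g •
            ((Aut.autMulEquivOfIso α).toMonoidHom.comp (𝒢.piHToPi K w' F')).range).relIndex
          (𝒢.piHToPi H w F).range = 0) :
    proposition_2_6.{v₁, u₁, u} := by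
  intro 𝒢 hc hgr hqc H K hH hK hHg hKg hcase w F _ w' F' _ α
  have h1 : ∀ g : 𝒢.Pi w.1 F, (ConjAct.toConjAct g •
      ((Aut.autMulEquivOfIso α).toMonoidHom.comp (𝒢.piHToPi K w' F')).range).relIndex
      (𝒢.piHToPi H w F).range = 0 := by
    intro g
    rcases hcase with ⟨v, hvH, hvK, hv⟩ | ⟨e, heH, heK, he⟩
    · exact proposition_2_6_i_of_isElevated 𝒢 hc hgr hqc H K hH hK v hvH hvK hv w F w' F' α g
    · exact hedge 𝒢 hc hgr hqc H K hH hK hHg hKg e heH heK he w F w' F' α g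
  exact ⟨h1, not_commensurable_conj_of_relIndex_eq_zero h1⟩

end SemiGraphOfAnabelioids

end Literature.AnabelianGeometry.SemiGraphs
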